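import Literature.MathematicalPhysics.QuantumLattice.KomaPiFluxPointwiseDoubleCommutator
import Literature.MathematicalPhysics.QuantumLattice.KomaPiFluxDirectionIndependence
import Literature.MathematicalPhysics.QuantumLattice.KomaPiFluxGroundStateOrder
import Literature.MathematicalPhysics.QuantumLattice.KomaPiFluxLongRangeOrderBound
import HarnessLib

/-!
# The Kennedy–Lieb–Shastry ground-state bound for Koma's `π`-flux BCS model:
# `e₁ ≤ m² + I_Λ √e₁ + 2√(κ/g) I_Λ` (pointwise infrared bound, zero temperature, any dimension)

T. Kennedy, E. H. Lieb, B. S. Shastry, Phys. Rev. Lett. 61 (1988) 2582 [KLS1988PRL], eqs. (4)–(8):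
in the ground state the infrared bound is used POINTWISE in the momentum `p` — `g_p ≤ ½[Σᵢ(e₁ - e₃cos pᵢ)
/Σᵢ(1 - cos pᵢ)]^{1/2}` (4), Kubo's `e₃ ≥ -e₁` gives (5), and the sum rule (6) yields
`e₁ ≤ ½ e₁^{1/2} I(ν) + m²` (7) with `I(ν) = (2π)^{-ν}∫[Σ(1+cos pᵢ)/Σ(1-cos pᵢ)]^{1/2}{ν⁻¹Σcos pᵢ}₊`
(8). T. Koma, arXiv:2201.13135 [Koma2022], §6, runs the same scheme for his `π`-flux BCS
pair-hopping fermions but (aiming at `d ≥ 3`, `T > 0`) bounds the double commutator only on the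
momentum AVERAGE ((6.24)–(6.33)), which loses the integrability needed in two dimensions.

This file carries out the POINTWISE version for Koma's model in the Lieb frame of this series
(`H₀ = KomaPiFlux.hamiltonian κ U g 0 0` on the even torus `(ℤ/Lℤ)^{d+1}`, `κ ≥ 0`, `g > 0`), at zero
temperature (tracial ground state `ω₀ = lim_{β→∞}⟨·⟩_β`, tree: `Matrix.tendsto_gibbsState_atTop_holds`):

* `KomaPiFlux.kls_pointwise_abstract` — the real-analysis core: a pointwise infrared bound
  `G_q ≤ ½√(Λc_q/(gE_q))`, a pointwise double-commutator bound `c_q ≤ a + b·Σᵢ(1+cos qᵢ)` on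
  `{C_q > 0}` and the sum rule give `Λ N₁ ≤ (d+1)M₀ + ½√(Λa/g)Σ_{q≠0}{C_q}₊/√E_q
  + ½√(Λb/g)Σ_{q≠0}{C_q}₊√(E⁺_q/E_q)` [KLS1988PRL, (4)–(7)];
* the zero-temperature data of `H₀`: the infrared bound `ground_modes_le` (limit of Koma's (6.16),
  tree `gibbs_modes_le`; the thermal term `|Λ|/(βgE_p)` drops out), the sum rule `ground_modes_sumRule`
  ((6.17)–(6.20)), the `η`-rotation symmetry `ground_gammaOne_mul_eq` ((6.31)), the direction
  independence `ground_sum_gammaOne_shift_eq`/`ground_sum_gammaThree_shift_eq` (§4), the hopping bound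
  `abs_re_ground_hopDC_le` ((6.26)), and from these plus Kubo's inequality the POINTWISE double-commutator
  bound `ground_doubleComm_le`: `c_q ≤ 16(d+1)κ|Λ| + 4g{n₁}₊Σᵢ(1 + cos qᵢ)` on `{C_q > 0}` ((6.28) with
  tree `re_modes_doubleComm_eq`; [KLS1988PRL, (4)–(5)]); the kernel sums `sum_posPart_div_sqrt_le`,
  `sum_posPart_mul_sqrt_eq` in terms of `klsRiemannSum`;
* **`KomaPiFlux.ground_kls_bound`**: GIVEN Kubo's inequality `N₃ ≥ -N₁` for `ω₀` (proved in
  `KomaPiFluxKuboInequality.lean`; taken here as the hypothesis `hKubo` so that this file does not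
  depend on it), `e₁ ≤ m² + I_Λ √{e₁}₊ + 2√(κ/g) I_Λ`, where `e₁ = KomaPiFlux.groundNnCorr H₀`
  (ground-state nearest-neighbour `Γ¹` correlation per site and direction), `m² = groundLroSq H₀`,
  and `I_Λ = klsRiemannSum (d+1) L` is the Riemann sum of KLS's `I(d+1)` (tree `XYOrderProofs`);
* `KomaPiFlux.groundNnCorr_ge`: `e₁ ≥ ½ - {U + 2g(d+1)}₊/(2g(d+1)) - 4κ/g` (limit of Koma's
  Lemma 6.1 / (6.7), tree `nnCorr_ge`).

Everything is PROVED; no named fact.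

## References

* [KLS1988PRL] T. Kennedy, E. H. Lieb, B. S. Shastry, Phys. Rev. Lett. 61 (1988) 2582, eqs. (4)–(8).
* [Koma2022] T. Koma, arXiv:2201.13135, Lemma 6.1, (6.7), (6.16)–(6.20), (6.26), (6.28), (6.31).
* [DLS1978] F. J. Dyson, E. H. Lieb, B. Simon, J. Stat. Phys. 18 (1978) 335, Thm. 3.2 / Cor. 3.2
  (the `β → ∞` form of the infrared bound).
-/

noncomputable section

namespace Literature.MathematicalPhysics.QuantumLattice

open Matrix Finset Filter Topology HubbardWave0 PairHopRP FermionTorus LiebCutRP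
open Literature.Probability.LatticeModels
open scoped ComplexOrder

namespace KomaPiFlux

attribute [local instance] LiebCutRP.decEqTorus

variable {d L : ℕ} [NeZero L]

/-! ### Kernel comparison: `{C_q}₊/√E_q ≤ √ν · F_ν(q)` and `{C_q}₊√(E⁺_q/E_q) = ν F_ν(q)` -/

omit [NeZero L] in
/-- `{Σcos pᵢ}₊/√(Σ(1 - cos pᵢ)) ≤ √ν · F_ν(p)`, `F_ν` the KLS integrand (on `{Σcos > 0}`,
`Σ(1 + cos pᵢ) ≥ ν`). [cite: KLS1988PRL, eq. (8)] -/
theorem posPart_cosSum_div_sqrt_le {ν : ℕ} (hν : 0 < ν) (p : Fin ν → ℝ) :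
    max (∑ i, Real.cos (p i)) 0 / Real.sqrt (∑ i, (1 - Real.cos (p i))) ≤
      Real.sqrt ν * klsIntegrand ν p := by
  have hF := klsIntegrand_nonneg ν p
  by_cases hC : ∑ i, Real.cos (p i) ≤ 0
  · rw [max_eq_right hC, zero_div]; positivity
  push Not at hC
  have hν' : (0 : ℝ) < ν := by exact_mod_cast hν
  set C := ∑ i, Real.cos (p i) with hCdef
  set E := ∑ i, (1 - Real.cos (p i)) with hEdef
  have hEp : ∑ i, (1 + Real.cos (p i)) = ν + C := by
    rw [sum_add_distrib, sum_const, card_univ, Fintype.card_fin, nsmul_eq_mul, mul_one]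
  by_cases hE : E ≤ 0
  · have hE0 : Real.sqrt E = 0 := Real.sqrt_eq_zero'.2 hE
    rw [hE0, div_zero]; positivity
  push Not at hE
  have hmax : max (C / ν) 0 = C / ν := max_eq_left (by positivity)
  rw [max_eq_left hC.le, klsIntegrand, hEp, ← hEdef, ← hCdef, hmax, Real.sqrt_div (by positivity),
    div_le_iff₀ (Real.sqrt_pos.2 hE)]
  have h1 : C ≤ Real.sqrt ν * Real.sqrt (ν + C) * (C / ν) := by
    have hs : (ν : ℝ) ≤ Real.sqrt ν * Real.sqrt (ν + C) := by
      rw [← Real.sqrt_mul hν'.le]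
      calc (ν : ℝ) = Real.sqrt ((ν : ℝ) * ν) := by rw [Real.sqrt_mul_self hν'.le]
        _ ≤ Real.sqrt (ν * (ν + C)) := Real.sqrt_le_sqrt (by nlinarith)
    calc C = ν * (C / ν) := by field_simp
      _ ≤ Real.sqrt ν * Real.sqrt (ν + C) * (C / ν) := by gcongr
  calc C ≤ Real.sqrt ν * Real.sqrt (ν + C) * (C / ν) := h1
    _ = Real.sqrt ν * (Real.sqrt (ν + C) / Real.sqrt E * (C / ν)) * Real.sqrt E := by
        field_simp

omit [NeZero L] in
/-- `{Σcos pᵢ}₊ √(Σ(1+cos pᵢ)/Σ(1-cos pᵢ)) = ν F_ν(p)`. [cite: KLS1988PRL, eq. (8)] -/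
theorem posPart_cosSum_mul_sqrt_eq {ν : ℕ} (hν : 0 < ν) (p : Fin ν → ℝ) :
    max (∑ i, Real.cos (p i)) 0 * Real.sqrt ((∑ i, (1 + Real.cos (p i))) / (∑ i, (1 - Real.cos (p i)))) =
      ν * klsIntegrand ν p := by
  have hν' : (0 : ℝ) < ν := by exact_mod_cast hν
  have hmax : max ((∑ i, Real.cos (p i)) / (ν : ℝ)) 0 = max (∑ i, Real.cos (p i)) 0 / ν := by
    rcases le_or_gt 0 (∑ i, Real.cos (p i)) with h | h
    · rw [max_eq_left h, max_eq_left (div_nonneg h hν'.le)]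
    · rw [max_eq_right h.le, max_eq_right (div_nonpos_of_nonpos_of_nonneg h.le hν'.le), zero_div]
  rw [klsIntegrand, hmax]
  field_simp

/-! ### The real-analysis core of KLS (4)–(7), pointwise form -/

omit [NeZero L] in
/-- `√(x + y) ≤ √x + √y` for `x, y ≥ 0`. [folklore] -/
private theorem sqrt_add_le' {x y : ℝ} (hx : 0 ≤ x) (hy : 0 ≤ y) : Real.sqrt (x + y) ≤ Real.sqrt x + Real.sqrt y := by
  rw [Real.sqrt_le_left]
  · nlinarith [Real.sqrt_nonneg x, Real.sqrt_nonneg y, Real.sq_sqrt hx, Real.sq_sqrt hy]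
  · positivity

/-- **KLS's pointwise step, abstract form.** On the dual torus of side `L` let `G_q ≥ 0` (structure
factor of the modes `q ≠ 0`) and `c_q` (their double commutators) satisfy the zero-temperature
infrared bound `G_q ≤ ½√(Λ c_q/(g E_q))` (`E_q = Σᵢ(1 - cos qᵢ)`), the POINTWISE double-commutator
bound `c_q ≤ a + b Σᵢ(1 + cos qᵢ)` on `{C_q > 0}` (`C_q = Σᵢ cos qᵢ`, `a, b ≥ 0`), and the sum rule
`Σ_{q≠0} G_q C_q + M₀ C_0 = Λ N₁`. Then
`Λ N₁ ≤ (d+1) M₀ + ½√(Λa/g) Σ_{q≠0}{C_q}₊/√E_q + ½√(Λb/g) Σ_{q≠0}{C_q}₊√(Σᵢ(1+cos qᵢ)/E_q)`.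
[cite: KLS1988PRL, eqs. (4)–(7)] [cite: Koma2022, (6.17)–(6.20)] -/
theorem kls_pointwise_abstract (G c : TorusSite (d + 1) L → ℝ) {g Λ N₁ M₀ a b : ℝ} (hg : 0 < g) (hΛ : 0 ≤ Λ)
    (ha : 0 ≤ a) (hb : 0 ≤ b)
    (hG : ∀ q : TorusSite (d + 1) L, q ≠ 0 → 0 ≤ G q)
    (hIR : ∀ q : TorusSite (d + 1) L, q ≠ 0 →
      G q ≤ 1 / 2 * Real.sqrt (Λ * c q / (g * dispersion (latticeMomentum L q))))
    (hDC : ∀ q : TorusSite (d + 1) L, q ≠ 0 → 0 < torusCosSum L q →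
      c q ≤ a + b * ∑ i, (1 + Real.cos (latticeMomentum L q i)))
    (hSR : ∑ q ∈ (univ : Finset (TorusSite (d + 1) L)).erase 0, G q * torusCosSum L q +
      M₀ * torusCosSum L (0 : TorusSite (d + 1) L) = Λ * N₁) :
    Λ * N₁ ≤ M₀ * (d + 1) +
      1 / 2 * Real.sqrt (Λ * a / g) * ∑ q ∈ (univ : Finset (TorusSite (d + 1) L)).erase 0,
        max (torusCosSum L q) 0 / Real.sqrt (dispersion (latticeMomentum L q)) +
      1 / 2 * Real.sqrt (Λ * b / g) * ∑ q ∈ (univ : Finset (TorusSite (d + 1) L)).erase 0,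
        max (torusCosSum L q) 0 *
          Real.sqrt ((∑ i, (1 + Real.cos (latticeMomentum L q i))) / dispersion (latticeMomentum L q)) := by
  set P : TorusSite (d + 1) L → ℝ := fun q => max (torusCosSum L q) 0 with hP
  set E : TorusSite (d + 1) L → ℝ := fun q => dispersion (latticeMomentum L q) with hE
  set Ep : TorusSite (d + 1) L → ℝ := fun q => ∑ i, (1 + Real.cos (latticeMomentum L q i)) with hEp
  set s' := (univ : Finset (TorusSite (d + 1) L)).erase 0 with hs'
  have hEpos : ∀ q ∈ s', 0 < E q := fun q hq => dispersion_latticeMomentum_pos (Finset.mem_erase.1 hq).1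
  have hPnn : ∀ q, 0 ≤ P q := fun q => le_max_right _ _
  have hEpnn : ∀ q, 0 ≤ Ep q := fun q => Finset.sum_nonneg fun i _ => by
    have := Real.neg_one_le_cos (latticeMomentum L q i); linarith
  -- pointwise: `G_q C_q ≤ {C_q}₊ · ½(√(Λa/(gE_q)) + √(Λ b E⁺_q/(g E_q)))`
  have h1 : ∀ q ∈ s', G q * torusCosSum L q ≤
      1 / 2 * Real.sqrt (Λ * a / g) * (P q / Real.sqrt (E q)) +
        1 / 2 * Real.sqrt (Λ * b / g) * (P q * Real.sqrt (Ep q / E q)) := by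
    intro q hq
    have hq0 : q ≠ 0 := (Finset.mem_erase.1 hq).1
    have hGq := hG q hq0
    have hEq := hEpos q hq
    rcases le_or_gt (torusCosSum L q) 0 with hC | hC
    · have hP0 : P q = 0 := max_eq_right hC
      rw [hP0, zero_div, zero_mul, mul_zero, mul_zero, add_zero]
      exact mul_nonpos_of_nonneg_of_nonpos hGq hC
    · have hPq : P q = torusCosSum L q := max_eq_left hC.le
      have hcq : c q ≤ a + b * Ep q := hDC q hq0 hC
      have hEpq := hEpnn q
      have hmono : Real.sqrt (Λ * c q / (g * E q)) ≤ Real.sqrt (Λ * (a + b * Ep q) / (g * E q)) := by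
        apply Real.sqrt_le_sqrt
        gcongr
      have hsplit : Real.sqrt (Λ * (a + b * Ep q) / (g * E q)) ≤
          Real.sqrt (Λ * a / g) / Real.sqrt (E q) + Real.sqrt (Λ * b / g) * Real.sqrt (Ep q / E q) := by
        have e1 : Λ * (a + b * Ep q) / (g * E q) = Λ * a / g / E q + Λ * b / g * (Ep q / E q) := by
          field_simp
        rw [e1, ← Real.sqrt_div' (Λ * a / g) hEq.le, ← Real.sqrt_mul' (Λ * b / g) (div_nonneg hEpq hEq.le)]
        exact sqrt_add_le' (by positivity) (by positivity)
      calc G q * torusCosSum L q ≤ 1 / 2 * Real.sqrt (Λ * c q / (g * E q)) * torusCosSum L q :=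
            mul_le_mul_of_nonneg_right (hIR q hq0) hC.le
        _ ≤ 1 / 2 * (Real.sqrt (Λ * a / g) / Real.sqrt (E q) + Real.sqrt (Λ * b / g) * Real.sqrt (Ep q / E q)) *
              torusCosSum L q := by
            gcongr
            exact hmono.trans hsplit
        _ = _ := by rw [hPq]; ring
  -- sum and assemble
  rw [torusCosSum_zero] at hSR
  have h3 : Λ * N₁ = ∑ q ∈ s', G q * torusCosSum L q + M₀ * ((d + 1 : ℕ) : ℝ) := hSR.symm
  rw [h3, Nat.cast_add, Nat.cast_one]
  have h4 : ∑ q ∈ s', G q * torusCosSum L q ≤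
      1 / 2 * Real.sqrt (Λ * a / g) * ∑ q ∈ s', P q / Real.sqrt (E q) +
        1 / 2 * Real.sqrt (Λ * b / g) * ∑ q ∈ s', P q * Real.sqrt (Ep q / E q) := by
    rw [Finset.mul_sum, Finset.mul_sum, ← Finset.sum_add_distrib]
    exact Finset.sum_le_sum h1
  linarith

/-! ### Zero-temperature correlation functions of `H₀` -/

/-- The zero-temperature nearest-neighbour `η`-pairing correlation per site and direction,
`e₁ = ((d+1)|Λ|)⁻¹ Σ_μ Σ_x Re ω₀(Γ¹_x Γ¹_{x+e_μ})` (the `β → ∞` limit of `nnCorr β H`, KLS's `e₁`).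
[cite: Koma2022, (6.18), (6.35)] [cite: KLS1988PRL, eq. (3)] -/
def groundNnCorr (H : Matrix (Finset (Orb (FermionTorus (d + 1) L))) (Finset (Orb (FermionTorus (d + 1) L))) ℂ) : ℝ :=
  (∑ μ : Fin (d + 1), ∑ x : FermionTorus (d + 1) L, (H.groundStateFunctional (gammaOne x * gammaOne (shift x μ))).re) /
    ((d + 1) * (L : ℝ) ^ (d + 1))

/-- `nnCorr β H → groundNnCorr H` as `β → ∞` (`H` Hermitian). [cite: Koma2022, (6.35)–(6.37)] -/
theorem tendsto_nnCorr_atTop {H : Matrix (Finset (Orb (FermionTorus (d + 1) L))) (Finset (Orb (FermionTorus (d + 1) L))) ℂ}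
    (hH : H.IsHermitian) : Tendsto (fun β : ℝ => nnCorr β H) atTop (𝓝 (groundNnCorr H)) := by
  unfold nnCorr groundNnCorr pairCorr
  refine Tendsto.div_const (tendsto_finsetSum _ fun μ _ => tendsto_finsetSum _ fun x _ => ?_) _
  exact (Complex.continuous_re.tendsto _).comp (Matrix.tendsto_gibbsState_atTop_holds hH _)

/-- **Zero-temperature lower bound on the nearest-neighbour correlation** (limit of Koma's Lemma 6.1):
`e₁ ≥ ½ - {U + 2g(d+1)}₊/(2g(d+1)) - 4κ/g` for `H₀ = H(κ,U;g,0;0)`, `κ ≥ 0`, `g > 0`, even `L ≥ 4`.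
[cite: Koma2022, Lemma 6.1, (6.7), (6.35)] -/
theorem groundNnCorr_ge (hL : Even L) (h4 : 4 ≤ L) {κ : ℝ} (hκ : 0 ≤ κ) (U : ℝ) {g : ℝ} (hg : 0 < g) :
    1 / 2 - max (U + 2 * g * (d + 1)) 0 / (2 * g * (d + 1)) - 4 * κ / g ≤
      groundNnCorr (hamiltonian κ U g (fun (_ _ : FermionTorus (d + 1) L) => (0 : ℝ)) 0) := by
  set H₀ := hamiltonian κ U g (fun (_ _ : FermionTorus (d + 1) L) => (0 : ℝ)) 0 with hH₀
  have hH : H₀.IsHermitian := hamiltonian_isHermitian (G d L) (piFluxAmpl κ) (piFluxAmpl_herm κ) U g _ 0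
  have hlim := tendsto_nnCorr_atTop hH
  have hden : Tendsto (fun β : ℝ => β * g * (d + 1)) atTop atTop :=
    (tendsto_id.atTop_mul_const hg).atTop_mul_const (by positivity)
  have h0 : Tendsto (fun β : ℝ => Real.log 4 / (β * g * (d + 1))) atTop (𝓝 0) := tendsto_const_nhds.div_atTop hden
  have hlow : Tendsto (fun β : ℝ => 1 / 2 - max (U + 2 * g * (d + 1)) 0 / (2 * g * (d + 1)) - 4 * κ / g -
      Real.log 4 / (β * g * (d + 1))) atTop (𝓝 (1 / 2 - max (U + 2 * g * (d + 1)) 0 / (2 * g * (d + 1)) - 4 * κ / g)) := by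
    simpa using tendsto_const_nhds.sub h0
  exact le_of_tendsto_of_tendsto hlow hlim ((eventually_gt_atTop 0).mono fun β hβ => nnCorr_ge hL h4 hβ hκ U hg)

/-- **The zero-temperature infrared bound, pointwise in `p`** (limit of Koma's (6.16); the thermal
term `|Λ|/(βgE_p)` drops out): `ω₀(C_p²) + ω₀(S_p²) ≤ ½ √(|Λ|(c(C_p) + c(S_p))/(g E_p))` with the
ground-state double commutators `c(A) = Re ω₀([A,[H₀,A]])`. [cite: Koma2022, (6.16)] [cite: DLS1978, Thm. 3.2]
[cite: KLS1988PRL, eq. (4)] -/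
theorem ground_modes_le (hL : Even L) (h4 : 4 ≤ L) {κ : ℝ} (hκ : 0 ≤ κ) (U : ℝ) {g : ℝ} (hg : 0 < g)
    {p : TorusSite (d + 1) L} (hp : 0 < dispersion (latticeMomentum L p)) :
    ((hamiltonian κ U g (fun (_ _ : FermionTorus (d + 1) L) => (0 : ℝ)) 0).groundStateFunctional
        (gammaOneMode (cosWave p) * gammaOneMode (cosWave p))).re +
      ((hamiltonian κ U g (fun (_ _ : FermionTorus (d + 1) L) => (0 : ℝ)) 0).groundStateFunctional
        (gammaOneMode (sinWave p) * gammaOneMode (sinWave p))).re ≤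
      1 / 2 * Real.sqrt ((L : ℝ) ^ (d + 1) *
        (((hamiltonian κ U g (fun (_ _ : FermionTorus (d + 1) L) => (0 : ℝ)) 0).groundStateFunctional
            (modeDC (hamiltonian κ U g (fun (_ _ : FermionTorus (d + 1) L) => (0 : ℝ)) 0) (gammaOneMode (cosWave p)))).re +
          ((hamiltonian κ U g (fun (_ _ : FermionTorus (d + 1) L) => (0 : ℝ)) 0).groundStateFunctional
            (modeDC (hamiltonian κ U g (fun (_ _ : FermionTorus (d + 1) L) => (0 : ℝ)) 0) (gammaOneMode (sinWave p)))).re) /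
        (g * dispersion (latticeMomentum L p))) := by
  set H₀ := hamiltonian κ U g (fun (_ _ : FermionTorus (d + 1) L) => (0 : ℝ)) 0 with hH₀
  have hH : H₀.IsHermitian := hamiltonian_isHermitian (G d L) (piFluxAmpl κ) (piFluxAmpl_herm κ) U g _ 0
  set A := gammaOneMode (L := L) (cosWave p) with hA
  set B := gammaOneMode (L := L) (sinWave p) with hB
  set E := dispersion (latticeMomentum L p) with hE
  have hT : ∀ X, Tendsto (fun β : ℝ => (gibbsState β H₀ X).re) atTop (𝓝 ((H₀.groundStateFunctional X).re)) := fun X =>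
    (Complex.continuous_re.tendsto _).comp (Matrix.tendsto_gibbsState_atTop_holds hH X)
  have hl : Tendsto (fun β : ℝ => (gibbsState β H₀ (A * A)).re + (gibbsState β H₀ (B * B)).re) atTop
      (𝓝 ((H₀.groundStateFunctional (A * A)).re + (H₀.groundStateFunctional (B * B)).re)) := (hT _).add (hT _)
  have hc : Tendsto (fun β : ℝ => doubleComm β H₀ A + doubleComm β H₀ B) atTop
      (𝓝 ((H₀.groundStateFunctional (modeDC H₀ A)).re + (H₀.groundStateFunctional (modeDC H₀ B)).re)) := by
    simp only [doubleComm_eq_re_gibbsState_modeDC]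
    exact (hT _).add (hT _)
  have h1 : Tendsto (fun β : ℝ => (L : ℝ) ^ (d + 1) / (β * g * E)) atTop (𝓝 0) :=
    tendsto_const_nhds.div_atTop ((tendsto_id.atTop_mul_const hg).atTop_mul_const hp)
  have hev : (fun β : ℝ => (L : ℝ) ^ (d + 1) / (g * E) * (doubleComm β H₀ A + doubleComm β H₀ B)) =ᶠ[atTop]
      fun β : ℝ => β * ((L : ℝ) ^ (d + 1) / (β * g * E)) * (doubleComm β H₀ A + doubleComm β H₀ B) := by
    filter_upwards [eventually_gt_atTop 0] with β hβ
    congr 1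
    field_simp
  have h2 : Tendsto (fun β : ℝ => 1 / 2 * Real.sqrt (β * ((L : ℝ) ^ (d + 1) / (β * g * E)) *
      (doubleComm β H₀ A + doubleComm β H₀ B))) atTop
      (𝓝 (1 / 2 * Real.sqrt ((L : ℝ) ^ (d + 1) / (g * E) *
        ((H₀.groundStateFunctional (modeDC H₀ A)).re + (H₀.groundStateFunctional (modeDC H₀ B)).re)))) :=
    (((tendsto_const_nhds.mul hc).congr' hev).sqrt).const_mul _
  have h12 := h1.add h2
  rw [zero_add, div_mul_eq_mul_div ((L : ℝ) ^ (d + 1)) (g * E)] at h12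
  exact le_of_tendsto_of_tendsto hl h12 ((eventually_gt_atTop 0).mono fun β hβ => gibbs_modes_le hL h4 hβ hκ U hg 0 hp)

/-- **The zero-temperature sum rule** (limit of Koma's (6.17)–(6.20), summed over the directions and
split at `p = 0`): `Σ_{p≠0} [ω₀(C_p²) + ω₀(S_p²)] C_p + |Λ|² m² (d+1) = |Λ| Σ_μ Σ_x Re ω₀(Γ¹_xΓ¹_{x+e_μ})`.
[cite: Koma2022, (6.17)–(6.20)] [cite: KLS1988PRL, eq. (6)] -/
theorem ground_modes_sumRule (κ U g : ℝ) :
    ∑ p ∈ (univ : Finset (TorusSite (d + 1) L)).erase 0,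
        (((hamiltonian κ U g (fun (_ _ : FermionTorus (d + 1) L) => (0 : ℝ)) 0).groundStateFunctional
            (gammaOneMode (cosWave p) * gammaOneMode (cosWave p))).re +
          ((hamiltonian κ U g (fun (_ _ : FermionTorus (d + 1) L) => (0 : ℝ)) 0).groundStateFunctional
            (gammaOneMode (sinWave p) * gammaOneMode (sinWave p))).re) * torusCosSum L p +
      (Fintype.card (FermionTorus (d + 1) L) : ℝ) ^ 2 *
        groundLroSq (hamiltonian κ U g (fun (_ _ : FermionTorus (d + 1) L) => (0 : ℝ)) 0) *
          torusCosSum L (0 : TorusSite (d + 1) L) =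
      (L : ℝ) ^ (d + 1) * ∑ μ : Fin (d + 1), ∑ x : FermionTorus (d + 1) L,
        ((hamiltonian κ U g (fun (_ _ : FermionTorus (d + 1) L) => (0 : ℝ)) 0).groundStateFunctional
          (gammaOne x * gammaOne (shift x μ))).re := by
  set H₀ := hamiltonian κ U g (fun (_ _ : FermionTorus (d + 1) L) => (0 : ℝ)) 0 with hH₀
  have hH : H₀.IsHermitian := hamiltonian_isHermitian (G d L) (piFluxAmpl κ) (piFluxAmpl_herm κ) U g _ 0
  have hT : ∀ X, Tendsto (fun β : ℝ => (gibbsState β H₀ X).re) atTop (𝓝 ((H₀.groundStateFunctional X).re)) := fun X =>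
    (Complex.continuous_re.tendsto _).comp (Matrix.tendsto_gibbsState_atTop_holds hH X)
  -- the finite-temperature identity
  have hSR : ∀ β : ℝ, ∑ p ∈ (univ : Finset (TorusSite (d + 1) L)).erase 0,
      ((gibbsState β H₀ (gammaOneMode (cosWave p) * gammaOneMode (cosWave p))).re +
        (gibbsState β H₀ (gammaOneMode (sinWave p) * gammaOneMode (sinWave p))).re) * torusCosSum L p +
      (Fintype.card (FermionTorus (d + 1) L) : ℝ) ^ 2 * lroSq β H₀ * torusCosSum L (0 : TorusSite (d + 1) L) =
      (L : ℝ) ^ (d + 1) * ∑ μ : Fin (d + 1), ∑ x : FermionTorus (d + 1) L, pairCorr β H₀ x (shift x μ) := by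
    intro β
    rw [modes_sum_split β H₀ (torusCosSum L)]
    simp only [torusCosSum, Finset.mul_sum]
    rw [Finset.sum_comm]
    refine Finset.sum_congr rfl fun i _ => ?_
    rw [← Finset.mul_sum, ← modes_weightedSumRule β H₀ i]
  -- both sides converge
  have hLHS : Tendsto (fun β : ℝ => ∑ p ∈ (univ : Finset (TorusSite (d + 1) L)).erase 0,
      ((gibbsState β H₀ (gammaOneMode (cosWave p) * gammaOneMode (cosWave p))).re +
        (gibbsState β H₀ (gammaOneMode (sinWave p) * gammaOneMode (sinWave p))).re) * torusCosSum L p +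
      (Fintype.card (FermionTorus (d + 1) L) : ℝ) ^ 2 * lroSq β H₀ * torusCosSum L (0 : TorusSite (d + 1) L)) atTop
      (𝓝 (∑ p ∈ (univ : Finset (TorusSite (d + 1) L)).erase 0,
        ((H₀.groundStateFunctional (gammaOneMode (cosWave p) * gammaOneMode (cosWave p))).re +
          (H₀.groundStateFunctional (gammaOneMode (sinWave p) * gammaOneMode (sinWave p))).re) * torusCosSum L p +
        (Fintype.card (FermionTorus (d + 1) L) : ℝ) ^ 2 * groundLroSq H₀ * torusCosSum L (0 : TorusSite (d + 1) L))) :=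
    (tendsto_finsetSum _ fun p _ => ((hT _).add (hT _)).mul_const _).add
      (((tendsto_lroSq_atTop hH).const_mul _).mul_const _)
  have hRHS : Tendsto (fun β : ℝ => (L : ℝ) ^ (d + 1) * ∑ μ : Fin (d + 1), ∑ x : FermionTorus (d + 1) L,
      pairCorr β H₀ x (shift x μ)) atTop
      (𝓝 ((L : ℝ) ^ (d + 1) * ∑ μ : Fin (d + 1), ∑ x : FermionTorus (d + 1) L,
        (H₀.groundStateFunctional (gammaOne x * gammaOne (shift x μ))).re)) :=
    (tendsto_finsetSum _ fun μ _ => tendsto_finsetSum _ fun x _ => hT _).const_mul _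
  exact tendsto_nhds_unique hLHS (hRHS.congr fun β => (hSR β).symm)

/-- `ω₀(Γ¹_xΓ¹_y) = ω₀(Γ²_xΓ²_y)` for `H₀` (limit of the `η`-rotation symmetry (6.31)). [cite: Koma2022, (6.31)] -/
theorem ground_gammaOne_mul_eq (κ U g : ℝ) (x y : FermionTorus (d + 1) L) :
    (hamiltonian κ U g (fun (_ _ : FermionTorus (d + 1) L) => (0 : ℝ)) 0).groundStateFunctional (gammaOne x * gammaOne y) =
      (hamiltonian κ U g (fun (_ _ : FermionTorus (d + 1) L) => (0 : ℝ)) 0).groundStateFunctional (gammaTwo x * gammaTwo y) := by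
  set H₀ := hamiltonian κ U g (fun (_ _ : FermionTorus (d + 1) L) => (0 : ℝ)) 0 with hH₀
  have hH : H₀.IsHermitian := hamiltonian_isHermitian (G d L) (piFluxAmpl κ) (piFluxAmpl_herm κ) U g _ 0
  have h1 := Matrix.tendsto_gibbsState_atTop_holds hH (gammaOne x * gammaOne y)
  have h2 := Matrix.tendsto_gibbsState_atTop_holds hH (gammaTwo x * gammaTwo y)
  refine tendsto_nhds_unique h1 (h2.congr fun β => ?_)
  rw [hH₀]
  unfold hamiltonian
  exact (gibbsState_gammaOne_mul_eq (G d L) β (piFluxAmpl κ) U g x y).symm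

/-- Direction independence at zero temperature, `Γ¹`: `Σ_x Re ω₀(Γ¹_xΓ¹_{x+e_ν})` does not depend on `ν`.
[cite: Koma2022, §4, (6.31)] -/
theorem ground_sum_gammaOne_shift_eq (hL : Even L) (h2 : 2 ≤ L) (κ U g : ℝ) (ν : Fin (d + 1)) :
    ∑ x : FermionTorus (d + 1) L, ((hamiltonian κ U g (fun (_ _ : FermionTorus (d + 1) L) => (0 : ℝ)) 0).groundStateFunctional
        (gammaOne x * gammaOne (shift x ν))).re =
      ∑ x : FermionTorus (d + 1) L, ((hamiltonian κ U g (fun (_ _ : FermionTorus (d + 1) L) => (0 : ℝ)) 0).groundStateFunctional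
        (gammaOne x * gammaOne (shift x 0))).re := by
  set H₀ := hamiltonian κ U g (fun (_ _ : FermionTorus (d + 1) L) => (0 : ℝ)) 0 with hH₀
  have hH : H₀.IsHermitian := hamiltonian_isHermitian (G d L) (piFluxAmpl κ) (piFluxAmpl_herm κ) U g _ 0
  have hT : ∀ X, Tendsto (fun β : ℝ => (gibbsState β H₀ X).re) atTop (𝓝 ((H₀.groundStateFunctional X).re)) := fun X =>
    (Complex.continuous_re.tendsto _).comp (Matrix.tendsto_gibbsState_atTop_holds hH X)
  refine tendsto_nhds_unique (tendsto_finsetSum _ fun x _ => hT _)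
    ((tendsto_finsetSum _ fun x _ => hT _).congr fun β => ?_)
  exact (sum_pairCorr_shift_eq hL h2 β κ U g 0 ν).symm

/-- Direction independence at zero temperature, `Γ³`: `Σ_x Re ω₀(Γ³_xΓ³_{x+e_ν})` does not depend on `ν`.
[cite: Koma2022, §4, (6.31)] -/
theorem ground_sum_gammaThree_shift_eq (hL : Even L) (h2 : 2 ≤ L) (κ U g : ℝ) (ν : Fin (d + 1)) :
    ∑ x : FermionTorus (d + 1) L, ((hamiltonian κ U g (fun (_ _ : FermionTorus (d + 1) L) => (0 : ℝ)) 0).groundStateFunctional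
        (gammaThree x * gammaThree (shift x ν))).re =
      ∑ x : FermionTorus (d + 1) L, ((hamiltonian κ U g (fun (_ _ : FermionTorus (d + 1) L) => (0 : ℝ)) 0).groundStateFunctional
        (gammaThree x * gammaThree (shift x 0))).re := by
  set H₀ := hamiltonian κ U g (fun (_ _ : FermionTorus (d + 1) L) => (0 : ℝ)) 0 with hH₀
  have hH : H₀.IsHermitian := hamiltonian_isHermitian (G d L) (piFluxAmpl κ) (piFluxAmpl_herm κ) U g _ 0
  have hT : ∀ X, Tendsto (fun β : ℝ => (gibbsState β H₀ X).re) atTop (𝓝 ((H₀.groundStateFunctional X).re)) := fun X =>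
    (Complex.continuous_re.tendsto _).comp (Matrix.tendsto_gibbsState_atTop_holds hH X)
  refine tendsto_nhds_unique (tendsto_finsetSum _ fun x _ => hT _)
    ((tendsto_finsetSum _ fun x _ => hT _).congr fun β => ?_)
  exact (sum_re_gibbsState_gammaThree_mul_shift_eq hL h2 β κ U g 0 ν).symm

/-- The zero-temperature hopping double commutator is small: `|Re ω₀(Σ_{x,y}cos(p·(x-y))[Γ¹_x,[K,Γ¹_y]])|
≤ 16(d+1)κ|Λ|` (limit of (6.26)). [cite: Koma2022, (6.26)] -/
theorem abs_re_ground_hopDC_le (h3 : 3 ≤ L) {κ : ℝ} (hκ : 0 ≤ κ) (U g : ℝ) (p : TorusSite (d + 1) L) :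
    |((hamiltonian κ U g (fun (_ _ : FermionTorus (d + 1) L) => (0 : ℝ)) 0).groundStateFunctional (hopDC κ p)).re| ≤
      16 * (d + 1) * κ * (L : ℝ) ^ (d + 1) := by
  set H₀ := hamiltonian κ U g (fun (_ _ : FermionTorus (d + 1) L) => (0 : ℝ)) 0 with hH₀
  have hH : H₀.IsHermitian := hamiltonian_isHermitian (G d L) (piFluxAmpl κ) (piFluxAmpl_herm κ) U g _ 0
  have hT : Tendsto (fun β : ℝ => |(gibbsState β H₀ (hopDC κ p)).re|) atTop (𝓝 |(H₀.groundStateFunctional (hopDC κ p)).re|) :=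
    (continuous_abs.tendsto _).comp ((Complex.continuous_re.tendsto _).comp (Matrix.tendsto_gibbsState_atTop_holds hH _))
  exact le_of_tendsto' hT fun β => abs_re_gibbsState_hopDC_le h3 hκ β hH p

omit [NeZero L] in
/-- `|Λ| = L^{d+1}` as a real number. [folklore] -/
private theorem card_torus_real : (Fintype.card (FermionTorus (d + 1) L) : ℝ) = (L : ℝ) ^ (d + 1) := by
  simp only [FermionTorus, Fintype.card_lex, Fintype.card_fun, Fintype.card_fin, Nat.cast_pow]

omit [NeZero L] in
/-- `Re ω₀(A²) ≥ 0` for Hermitian `A`. [cite: BratteliRobinson1997, §5.3.1] -/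
private theorem re_ground_sq_nonneg (H : Matrix (Finset (Orb (FermionTorus (d + 1) L))) (Finset (Orb (FermionTorus (d + 1) L))) ℂ)
    {A : Matrix (Finset (Orb (FermionTorus (d + 1) L))) (Finset (Orb (FermionTorus (d + 1) L))) ℂ} (hA : A.IsHermitian) :
    0 ≤ (H.groundStateFunctional (A * A)).re := by
  have h := groundStateFunctional_nonneg H A
  rw [hA.eq] at h
  exact (Complex.nonneg_iff.mp h).1

/-! ### The pointwise double-commutator bound at zero temperature (KLS (4)–(5) with Kubo) -/

/-- **Pointwise bound on the ground-state double commutator on `{C_q > 0}`**: with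
`n₁ = Σ_x Re ω₀(Γ¹_xΓ¹_{x+e₀})`, `n₃ = Σ_x Re ω₀(Γ³_xΓ³_{x+e₀})` (direction-independent) and Kubo's
`n₃ ≥ -n₁`, `c(C_q) + c(S_q) = Re ω₀(hop) + 4g(d+1)n₁ - 4g C_q n₃ ≤ 16(d+1)κ|Λ| + 4g{n₁}₊ Σᵢ(1 + cos qᵢ)`.
[cite: KLS1988PRL, eqs. (4)–(5)] [cite: Koma2022, (6.26), (6.28), (6.31)] -/
theorem ground_doubleComm_le (hL : Even L) (h3 : 3 ≤ L) {κ : ℝ} (hκ : 0 ≤ κ) (U : ℝ) {g : ℝ} (hg : 0 ≤ g)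
    (hKubo : -(∑ μ : Fin (d + 1), ∑ x : FermionTorus (d + 1) L,
        ((hamiltonian κ U g (fun (_ _ : FermionTorus (d + 1) L) => (0 : ℝ)) 0).groundStateFunctional
          (gammaOne x * gammaOne (shift x μ))).re) ≤
      ∑ μ : Fin (d + 1), ∑ x : FermionTorus (d + 1) L,
        ((hamiltonian κ U g (fun (_ _ : FermionTorus (d + 1) L) => (0 : ℝ)) 0).groundStateFunctional
          (gammaThree x * gammaThree (shift x μ))).re)
    (q : TorusSite (d + 1) L) (hC : 0 < torusCosSum L q) :
    ((hamiltonian κ U g (fun (_ _ : FermionTorus (d + 1) L) => (0 : ℝ)) 0).groundStateFunctional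
        (modeDC (hamiltonian κ U g (fun (_ _ : FermionTorus (d + 1) L) => (0 : ℝ)) 0) (gammaOneMode (cosWave q)))).re +
      ((hamiltonian κ U g (fun (_ _ : FermionTorus (d + 1) L) => (0 : ℝ)) 0).groundStateFunctional
        (modeDC (hamiltonian κ U g (fun (_ _ : FermionTorus (d + 1) L) => (0 : ℝ)) 0) (gammaOneMode (sinWave q)))).re ≤
      16 * (d + 1) * κ * (L : ℝ) ^ (d + 1) +
        4 * g * max (∑ x : FermionTorus (d + 1) L,
          ((hamiltonian κ U g (fun (_ _ : FermionTorus (d + 1) L) => (0 : ℝ)) 0).groundStateFunctional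
            (gammaOne x * gammaOne (shift x 0))).re) 0 *
          ∑ i, (1 + Real.cos (latticeMomentum L q i)) := by
  have h2 : 2 ≤ L := by omega
  set H₀ := hamiltonian κ U g (fun (_ _ : FermionTorus (d + 1) L) => (0 : ℝ)) 0 with hH₀
  set n1 := ∑ x : FermionTorus (d + 1) L, (H₀.groundStateFunctional (gammaOne x * gammaOne (shift x 0))).re with hn1
  set n3 := ∑ x : FermionTorus (d + 1) L, (H₀.groundStateFunctional (gammaThree x * gammaThree (shift x 0))).re with hn3
  have hrot : ∀ x y : FermionTorus (d + 1) L, (H₀.groundStateFunctional (gammaTwo x * gammaTwo y)).re =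
      (H₀.groundStateFunctional (gammaOne x * gammaOne y)).re := fun x y => by
    rw [show H₀.groundStateFunctional (gammaOne x * gammaOne y) = H₀.groundStateFunctional (gammaTwo x * gammaTwo y) from
      ground_gammaOne_mul_eq κ U g x y]
  have hdir1 : ∀ ν : Fin (d + 1), ∑ x : FermionTorus (d + 1) L,
      (H₀.groundStateFunctional (gammaOne x * gammaOne (shift x ν))).re = n1 := fun ν => ground_sum_gammaOne_shift_eq hL h2 κ U g ν
  have hdir3 : ∀ ν : Fin (d + 1), ∑ x : FermionTorus (d + 1) L,
      (H₀.groundStateFunctional (gammaThree x * gammaThree (shift x ν))).re = n3 :=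
    fun ν => ground_sum_gammaThree_shift_eq hL h2 κ U g ν
  have hN₁ : ∑ μ : Fin (d + 1), ∑ x : FermionTorus (d + 1) L,
      (H₀.groundStateFunctional (gammaOne x * gammaOne (shift x μ))).re = (d + 1) * n1 := by
    rw [Finset.sum_congr rfl fun μ _ => hdir1 μ, Finset.sum_const, Finset.card_univ, Fintype.card_fin, nsmul_eq_mul]
    push_cast
    ring
  have hN₃ : ∑ μ : Fin (d + 1), ∑ x : FermionTorus (d + 1) L,
      (H₀.groundStateFunctional (gammaThree x * gammaThree (shift x μ))).re = (d + 1) * n3 := by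
    rw [Finset.sum_congr rfl fun μ _ => hdir3 μ, Finset.sum_const, Finset.card_univ, Fintype.card_fin, nsmul_eq_mul]
    push_cast
    ring
  have hD : (0 : ℝ) < d + 1 := by positivity
  have hKubo' : -n1 ≤ n3 := by
    rw [hN₁, hN₃] at hKubo
    nlinarith
  have hc_eq := re_modes_doubleComm_eq h3 κ U g q H₀.groundStateFunctional
  have e2 : ∑ μ : Fin (d + 1), ∑ x : FermionTorus (d + 1) L,
      (H₀.groundStateFunctional (gammaTwo x * gammaTwo (shift x μ))).re = (d + 1) * n1 := by
    rw [← hN₁]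
    exact Finset.sum_congr rfl fun μ _ => Finset.sum_congr rfl fun x _ => hrot x _
  have e3 : ∑ μ : Fin (d + 1), Real.cos (latticeMomentum L q μ) *
      ∑ x : FermionTorus (d + 1) L, (H₀.groundStateFunctional (gammaThree x * gammaThree (shift x μ))).re =
      torusCosSum L q * n3 := by
    rw [torusCosSum, Finset.sum_mul]
    exact Finset.sum_congr rfl fun μ _ => by rw [hdir3 μ]
  have hh := (abs_le.1 (abs_re_ground_hopDC_le (d := d) h3 hκ U g q)).2
  rw [← hH₀] at hc_eq
  rw [hc_eq, e2, e3, sum_one_add_cos_latticeMomentum]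
  push_cast
  have hm : n1 ≤ max n1 0 := le_max_left _ _
  have hm0 : 0 ≤ max n1 0 := le_max_right _ _
  have hk : -(torusCosSum L q * n3) ≤ torusCosSum L q * max n1 0 := by nlinarith
  have h4g : 0 ≤ 4 * g := by positivity
  have hA : 4 * g * ((d + 1) * n1) ≤ 4 * g * ((d + 1) * max n1 0) :=
    mul_le_mul_of_nonneg_left (mul_le_mul_of_nonneg_left hm hD.le) h4g
  have hB : -(4 * g * (torusCosSum L q * n3)) ≤ 4 * g * (torusCosSum L q * max n1 0) := by
    rw [← mul_neg]
    exact mul_le_mul_of_nonneg_left hk h4g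
  linarith

/-- The kernel sum `Σ_{q≠0} {C_q}₊/√E_q ≤ √(d+1) · I_Λ · |Λ|`. [cite: KLS1988PRL, eq. (8)] -/
theorem sum_posPart_div_sqrt_le :
    ∑ q ∈ (univ : Finset (TorusSite (d + 1) L)).erase 0,
        max (torusCosSum L q) 0 / Real.sqrt (dispersion (latticeMomentum L q)) ≤
      Real.sqrt ((d + 1 : ℕ) : ℝ) * (klsRiemannSum (d + 1) L * (L : ℝ) ^ (d + 1)) := by
  have hL0 : (0 : ℝ) < (L : ℝ) ^ (d + 1) := by
    have : (0 : ℝ) < L := by exact_mod_cast Nat.pos_of_ne_zero (NeZero.ne L)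
    positivity
  rw [klsRiemannSum_of_neZero, div_mul_cancel₀ _ hL0.ne', Finset.mul_sum]
  exact Finset.sum_le_sum fun q _ => posPart_cosSum_div_sqrt_le (Nat.succ_pos d) (latticeMomentum L q)

/-- The kernel sum `Σ_{q≠0} {C_q}₊√(E⁺_q/E_q) = (d+1) · I_Λ · |Λ|`. [cite: KLS1988PRL, eq. (8)] -/
theorem sum_posPart_mul_sqrt_eq :
    ∑ q ∈ (univ : Finset (TorusSite (d + 1) L)).erase 0,
        max (torusCosSum L q) 0 * Real.sqrt ((∑ i, (1 + Real.cos (latticeMomentum L q i))) / dispersion (latticeMomentum L q)) =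
      ((d + 1 : ℕ) : ℝ) * (klsRiemannSum (d + 1) L * (L : ℝ) ^ (d + 1)) := by
  have hL0 : (0 : ℝ) < (L : ℝ) ^ (d + 1) := by
    have : (0 : ℝ) < L := by exact_mod_cast Nat.pos_of_ne_zero (NeZero.ne L)
    positivity
  rw [klsRiemannSum_of_neZero, div_mul_cancel₀ _ hL0.ne', Finset.mul_sum]
  exact Finset.sum_congr rfl fun q _ => posPart_cosSum_mul_sqrt_eq (Nat.succ_pos d) (latticeMomentum L q)

/-! ### The ground-state KLS bound -/

/-- **The Kennedy–Lieb–Shastry ground-state bound for Koma's `π`-flux BCS model** (Lieb frame,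
`H₀ = H(κ,U;g,0;0)` on the even torus `(ℤ/Lℤ)^{d+1}`, `L ≥ 4`, `κ ≥ 0`, `g > 0`, any `U`, any `d`):
GIVEN Kubo's inequality `Σ_μΣ_x Re ω₀(Γ³_xΓ³_{x+e_μ}) ≥ -Σ_μΣ_x Re ω₀(Γ¹_xΓ¹_{x+e_μ})` for the tracial
ground state `ω₀` of `H₀` (hypothesis `hKubo`; proved in `KomaPiFluxKuboInequality.lean`),
`e₁ ≤ m² + I_Λ √{e₁}₊ + 2 √(κ/g) I_Λ`,
where `e₁ = groundNnCorr H₀`, `m² = groundLroSq H₀` and `I_Λ = klsRiemannSum (d+1) L` is the Riemann sum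
of KLS's `I(d+1)` over the nonzero momenta of the dual torus. This is KLS's (7) `e₁ ≤ ½e₁^{1/2}I(ν) + m²`
(in `η`-Pauli units `Γ = 2S`: `e₁^Γ = 4e₁^S`, `m²_Γ = 4m²_S`) plus the `π`-flux hopping correction
`2√(κ/g)I_Λ` from Koma's (6.26). [cite: KLS1988PRL, eqs. (4)–(7)] [cite: Koma2022, (6.16)–(6.20), (6.26), (6.28), (6.31)] -/
theorem ground_kls_bound (hL : Even L) (h4 : 4 ≤ L) {κ : ℝ} (hκ : 0 ≤ κ) (U : ℝ) {g : ℝ} (hg : 0 < g)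
    (hKubo : -(∑ μ : Fin (d + 1), ∑ x : FermionTorus (d + 1) L,
        ((hamiltonian κ U g (fun (_ _ : FermionTorus (d + 1) L) => (0 : ℝ)) 0).groundStateFunctional
          (gammaOne x * gammaOne (shift x μ))).re) ≤
      ∑ μ : Fin (d + 1), ∑ x : FermionTorus (d + 1) L,
        ((hamiltonian κ U g (fun (_ _ : FermionTorus (d + 1) L) => (0 : ℝ)) 0).groundStateFunctional
          (gammaThree x * gammaThree (shift x μ))).re) :
    groundNnCorr (hamiltonian κ U g (fun (_ _ : FermionTorus (d + 1) L) => (0 : ℝ)) 0) ≤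
      groundLroSq (hamiltonian κ U g (fun (_ _ : FermionTorus (d + 1) L) => (0 : ℝ)) 0) +
        klsRiemannSum (d + 1) L *
          Real.sqrt (max (groundNnCorr (hamiltonian κ U g (fun (_ _ : FermionTorus (d + 1) L) => (0 : ℝ)) 0)) 0) +
        2 * Real.sqrt (κ / g) * klsRiemannSum (d + 1) L := by
  have h3 : 3 ≤ L := by omega
  have h2 : 2 ≤ L := by omega
  set H₀ := hamiltonian κ U g (fun (_ _ : FermionTorus (d + 1) L) => (0 : ℝ)) 0 with hH₀
  obtain ⟨Λr, hΛr⟩ : ∃ Λr : ℝ, Λr = (L : ℝ) ^ (d + 1) := ⟨_, rfl⟩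
  have hL0 : (0 : ℝ) < L := by exact_mod_cast Nat.pos_of_ne_zero (NeZero.ne L)
  have hΛpos : 0 < Λr := by rw [hΛr]; positivity
  obtain ⟨n1, hn1⟩ : ∃ n1 : ℝ, n1 = ∑ x : FermionTorus (d + 1) L,
    (H₀.groundStateFunctional (gammaOne x * gammaOne (shift x 0))).re := ⟨_, rfl⟩
  obtain ⟨R, hR⟩ : ∃ R : ℝ, R = klsRiemannSum (d + 1) L := ⟨_, rfl⟩
  have hR0 : 0 ≤ R := by rw [hR]; exact klsRiemannSum_nonneg _ _
  have hN₁ : ∑ μ : Fin (d + 1), ∑ x : FermionTorus (d + 1) L,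
      (H₀.groundStateFunctional (gammaOne x * gammaOne (shift x μ))).re = (d + 1) * n1 := by
    rw [Finset.sum_congr rfl fun μ _ => ground_sum_gammaOne_shift_eq hL h2 κ U g μ, Finset.sum_const, Finset.card_univ,
      Fintype.card_fin, nsmul_eq_mul, ← hn1]
    push_cast
    ring
  -- the abstract step
  have key : Λr * ((d + 1) * n1) ≤ (Fintype.card (FermionTorus (d + 1) L) : ℝ) ^ 2 * groundLroSq H₀ * (d + 1) +
      1 / 2 * Real.sqrt (Λr * (16 * (d + 1) * κ * Λr) / g) * ∑ q ∈ (univ : Finset (TorusSite (d + 1) L)).erase 0,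
        max (torusCosSum L q) 0 / Real.sqrt (dispersion (latticeMomentum L q)) +
      1 / 2 * Real.sqrt (Λr * (4 * g * max n1 0) / g) * ∑ q ∈ (univ : Finset (TorusSite (d + 1) L)).erase 0,
        max (torusCosSum L q) 0 *
          Real.sqrt ((∑ i, (1 + Real.cos (latticeMomentum L q i))) / dispersion (latticeMomentum L q)) := by
    refine kls_pointwise_abstract
      (fun q => (H₀.groundStateFunctional (gammaOneMode (cosWave q) * gammaOneMode (cosWave q))).re +
        (H₀.groundStateFunctional (gammaOneMode (sinWave q) * gammaOneMode (sinWave q))).re)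
      (fun q => (H₀.groundStateFunctional (modeDC H₀ (gammaOneMode (cosWave q)))).re +
        (H₀.groundStateFunctional (modeDC H₀ (gammaOneMode (sinWave q)))).re)
      hg hΛpos.le (by positivity) (by positivity) (fun q _ => add_nonneg (re_ground_sq_nonneg H₀ (gammaOneMode_isHermitian _))
        (re_ground_sq_nonneg H₀ (gammaOneMode_isHermitian _))) (fun q hq => ?_) (fun q _ hC => ?_) ?_
    · rw [hΛr]
      exact ground_modes_le hL h4 hκ U hg (dispersion_latticeMomentum_pos hq)
    · rw [hΛr, hn1]
      exact ground_doubleComm_le hL h3 hκ U hg.le hKubo q hC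
    · have h := ground_modes_sumRule (d := d) (L := L) κ U g
      rw [← hH₀, hN₁, ← hΛr] at h
      exact h
  -- name the two kernel sums and bound them by the KLS Riemann sum
  obtain ⟨S₁, hS₁⟩ : ∃ S : ℝ, S = ∑ q ∈ (univ : Finset (TorusSite (d + 1) L)).erase 0,
      max (torusCosSum L q) 0 / Real.sqrt (dispersion (latticeMomentum L q)) := ⟨_, rfl⟩
  obtain ⟨S₂, hS₂⟩ : ∃ S : ℝ, S = ∑ q ∈ (univ : Finset (TorusSite (d + 1) L)).erase 0,
      max (torusCosSum L q) 0 *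
        Real.sqrt ((∑ i, (1 + Real.cos (latticeMomentum L q i))) / dispersion (latticeMomentum L q)) := ⟨_, rfl⟩
  rw [← hS₁, ← hS₂, card_torus_real, ← hΛr] at key
  have hS1le : S₁ ≤ Real.sqrt ((d + 1 : ℕ) : ℝ) * (R * Λr) := by
    rw [hS₁, hR, hΛr]
    exact sum_posPart_div_sqrt_le
  have hS2eq : S₂ = ((d + 1 : ℕ) : ℝ) * (R * Λr) := by
    rw [hS₂, hR, hΛr]
    exact sum_posPart_mul_sqrt_eq
  push_cast at hS1le hS2eq
  -- simplify the square roots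
  have hs1 : Real.sqrt (Λr * (16 * (d + 1) * κ * Λr) / g) * Real.sqrt ((d : ℝ) + 1) = 4 * Λr * (d + 1) * Real.sqrt (κ / g) := by
    have hnn : 0 ≤ Λr * (16 * (d + 1) * κ * Λr) / g := by positivity
    rw [← Real.sqrt_mul hnn, show Λr * (16 * (d + 1) * κ * Λr) / g * ((d : ℝ) + 1) = (4 * Λr * (d + 1)) ^ 2 * (κ / g) by ring,
      Real.sqrt_mul (sq_nonneg _), Real.sqrt_sq (by positivity)]
  have hs2 : Real.sqrt (Λr * (4 * g * max n1 0) / g) = 2 * (Real.sqrt Λr * Real.sqrt (max n1 0)) := by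
    rw [show Λr * (4 * g * max n1 0) / g = 2 ^ 2 * (Λr * max n1 0) by field_simp; ring, Real.sqrt_mul (sq_nonneg _),
      Real.sqrt_sq (by norm_num), Real.sqrt_mul hΛpos.le]
  have hT2 : 1 / 2 * Real.sqrt (Λr * (16 * (d + 1) * κ * Λr) / g) * S₁ ≤ 2 * Λr * (d + 1) * Real.sqrt (κ / g) * (R * Λr) := by
    calc 1 / 2 * Real.sqrt (Λr * (16 * (d + 1) * κ * Λr) / g) * S₁
        ≤ 1 / 2 * Real.sqrt (Λr * (16 * (d + 1) * κ * Λr) / g) * (Real.sqrt ((d : ℝ) + 1) * (R * Λr)) := by gcongr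
      _ = 1 / 2 * (Real.sqrt (Λr * (16 * (d + 1) * κ * Λr) / g) * Real.sqrt ((d : ℝ) + 1)) * (R * Λr) := by ring
      _ = 2 * Λr * (d + 1) * Real.sqrt (κ / g) * (R * Λr) := by rw [hs1]; ring
  have hT3 : 1 / 2 * Real.sqrt (Λr * (4 * g * max n1 0) / g) * S₂ =
      (d + 1) * (R * Λr) * (Real.sqrt Λr * Real.sqrt (max n1 0)) := by
    rw [hs2, hS2eq]; ring
  rw [hT3] at key
  -- divide by `(d+1) Λr`
  have hv : Real.sqrt Λr * Real.sqrt Λr = Λr := Real.mul_self_sqrt hΛpos.le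
  have hv0 : 0 < Real.sqrt Λr := Real.sqrt_pos.2 hΛpos
  have hfin : n1 ≤ Λr * groundLroSq H₀ + 2 * Real.sqrt (κ / g) * R * Λr + R * (Real.sqrt Λr * Real.sqrt (max n1 0)) := by
    have hc : 0 < ((d : ℝ) + 1) * Λr := by positivity
    refine le_of_mul_le_mul_left ?_ hc
    calc ((d : ℝ) + 1) * Λr * n1 = Λr * ((d + 1) * n1) := by ring
      _ ≤ Λr ^ 2 * groundLroSq H₀ * (d + 1) + 2 * Λr * (d + 1) * Real.sqrt (κ / g) * (R * Λr) +
            (d + 1) * (R * Λr) * (Real.sqrt Λr * Real.sqrt (max n1 0)) := by linarith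
      _ = ((d : ℝ) + 1) * Λr * (Λr * groundLroSq H₀ + 2 * Real.sqrt (κ / g) * R * Λr +
            R * (Real.sqrt Λr * Real.sqrt (max n1 0))) := by ring
  -- express the target in terms of `n1 / Λr`
  have he1 : groundNnCorr H₀ = n1 / Λr := by
    rw [groundNnCorr, hN₁, ← hΛr, mul_div_mul_left _ _ (by positivity : ((d : ℝ) + 1) ≠ 0)]
  have hmaxe : max (n1 / Λr) 0 = max n1 0 / Λr := by
    rw [← max_div_div_right hΛpos.le, zero_div]
  have hprod : Real.sqrt (max n1 0) / Real.sqrt Λr * Λr = Real.sqrt Λr * Real.sqrt (max n1 0) := by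
    rw [div_mul_eq_mul_div, div_eq_iff hv0.ne']
    calc Real.sqrt (max n1 0) * Λr = Real.sqrt (max n1 0) * (Real.sqrt Λr * Real.sqrt Λr) := by rw [hv]
      _ = Real.sqrt Λr * Real.sqrt (max n1 0) * Real.sqrt Λr := by ring
  rw [← hR, he1, hmaxe, Real.sqrt_div' _ hΛpos.le, div_le_iff₀ hΛpos, add_mul, add_mul, mul_assoc R, hprod]
  linarith

end KomaPiFlux




end Literature.MathematicalPhysics.QuantumLattice

end
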